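import Mathlib
import HarnessLib
import Summits.MatrixMultiplication.MatrixMultiplication.Theorems.OutsiderSandwichToricCeilingPowMixedRulesPure

/-!
# OutsiderSandwich — mixed-basis toric ceiling `⟨3^N - 2⟩`, part 4: the NEW PURE slice
(decomp-mm lens 4, gen 46, kernel K46-4; THESES-FREE, `ω`-free; helper toward `LaserTangency`,
stmt-32268 — the extremal subrank/packing cells of the literal host `kroneckerPow (cwTensor ℂ 2) N`)

LABEL.  TORIC · uniform in `N` · NEC-side instrument (a slice construction of the mixed machine;
the theorem is assembled in a later part); the rates, the crux `h₁ = LaserTangency` and the route's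
`closes` are untouched.

WHAT.  `pure_core` / `twoPMκ_pure`: in a product frame `frame κ` (`κ` with cw and permutation
coordinates), at a PERMUTATION pivot `p` where the six missing words `x₁ x₂ | y₁ y₂ | z₁ z₂` have
the PURE pattern `x₁ₚ = x₂ₚ = a`, `y₁ₚ = y₂ₚ = a + 2d`, `z₁ₚ = z₂ₚ = a + d` (`d ≠ 0`), the
complement of `({x₁,x₂}, {y₁,y₂}, {z₁,z₂})` has a perfect matching, built from perfect matchings of
THREE co-size-2 tail instances (induction hypothesis `ih`, one per slot of the primary direction
`d`) and FOUR auxiliary triples of direction `2d` (`puT`; tail letters by the two-basis rule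
`…PowMixedRulesPure.puκ`, selector `ρ`): slot `a`: `({x₁',x₂'}, {v₂,v₂'}, {w₁,w₁'})`, slot `a+d`:
`({u₁,u₁'}, {y₁',y₂'}, {w₂,w₂'})`, slot `a+2d`: `({u₂,u₂'}, {v₁,v₁'}, {z₁',z₂'})`.  The word-level
flags (`u₁ ≠ u₁'`, …) come from ONE permutation tail coordinate `j₀` (so the slice needs `N ≥ 3`
when `κ` has a cw coordinate), and the SECOND matching (`twoPMκ_pure`) from switching the cw rule
at ONE cw tail coordinate `j₁`: the auxiliary triples are intrinsic (the direction-`2d` triples of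
the matching) and the two cw rules never give the same pair of auxiliary row sets (`puκ_diff`).
This replaces the PURE slice of the tight case (`…PowSubTwo.twoPM_pure`: two full slots matched by
parallel classes), which has no analogue when a cw coordinate is present (NODE-g46 §3).
-/

set_option linter.dupNamespace false

namespace Summit.MatrixMultiplication.MatrixMultiplication.Theorems.OutsiderSandwichToricCeilingPowMixedPure

open Finset
open Summit.MatrixMultiplication.MatrixMultiplication.Theorems.OutsiderSandwichToricCeilingPowFibres
  (Word Tr3 slotB frame)
open Summit.MatrixMultiplication.MatrixMultiplication.Theorems.OutsiderSandwichToricCeilingPowSubTwoGlue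
open Summit.MatrixMultiplication.MatrixMultiplication.Theorems.OutsiderSandwichToricCeilingPowSubTwoRules
open Summit.MatrixMultiplication.MatrixMultiplication.Theorems.OutsiderSandwichToricCeilingPowMixedGlue
open Summit.MatrixMultiplication.MatrixMultiplication.Theorems.OutsiderSandwichToricCeilingPowMixedRules
open Summit.MatrixMultiplication.MatrixMultiplication.Theorems.OutsiderSandwichToricCeilingPowMixedRulesPure

variable {m : ℕ}

/-! ## §1 Auxiliary words and triples of the PURE slice -/

/-- Tail word of an auxiliary PURE row: the two-basis rule (basis flag `κ (p.succAbove j)`, selector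
`ρ j`) applied to the six missing letters at the tail coordinate `j`. [new] -/
def puLet (f : Bool → Bool → Fin 3 → Fin 3 → Fin 3 → Fin 3 → Fin 3 → Fin 3 → Fin 3)
    (p : Fin (m + 1)) (κ : Fin (m + 1) → Bool) (ρ : Fin m → Bool)
    (x₁ x₂ y₁ y₂ z₁ z₂ : Word (m + 1)) : Word m :=
  fun j => f (κ (p.succAbove j)) (ρ j) (x₁ (p.succAbove j)) (x₂ (p.succAbove j))
    (y₁ (p.succAbove j)) (y₂ (p.succAbove j)) (z₁ (p.succAbove j)) (z₂ (p.succAbove j))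

/-- `puLet` evaluated. -/
@[simp] theorem puLet_apply
    (f : Bool → Bool → Fin 3 → Fin 3 → Fin 3 → Fin 3 → Fin 3 → Fin 3 → Fin 3) (p : Fin (m + 1))
    (κ : Fin (m + 1) → Bool) (ρ : Fin m → Bool) (x₁ x₂ y₁ y₂ z₁ z₂ : Word (m + 1)) (j : Fin m) :
    puLet f p κ ρ x₁ x₂ y₁ y₂ z₁ z₂ j = f (κ (p.succAbove j)) (ρ j) (x₁ (p.succAbove j))
      (x₂ (p.succAbove j)) (y₁ (p.succAbove j)) (y₂ (p.succAbove j)) (z₁ (p.succAbove j))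
      (z₂ (p.succAbove j)) := rfl

/-- The four auxiliary triples of the PURE slice at pivot `p` (letters `a, a+2d, a+d`, selector
`ρ`): `T₁, T₁' ∈ (a+d, a, a+2d)` and `T₂, T₂' ∈ (a+2d, a+d, a)`. [new] -/
def puT (p : Fin (m + 1)) (a d : Fin 3) (κ : Fin (m + 1) → Bool) (ρ : Fin m → Bool)
    (x₁ x₂ y₁ y₂ z₁ z₂ : Word (m + 1)) : Finset (Tr3 (m + 1)) :=
  {(ins p (a + d) (puLet puU₁ p κ ρ x₁ x₂ y₁ y₂ z₁ z₂),
      ins p a (puLet puV₁ p κ ρ x₁ x₂ y₁ y₂ z₁ z₂),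
      ins p (a + d + d) (puLet puW₁ p κ ρ x₁ x₂ y₁ y₂ z₁ z₂)),
    (ins p (a + d) (puLet puU₁' p κ ρ x₁ x₂ y₁ y₂ z₁ z₂),
      ins p a (puLet puV₁' p κ ρ x₁ x₂ y₁ y₂ z₁ z₂),
      ins p (a + d + d) (puLet puW₁' p κ ρ x₁ x₂ y₁ y₂ z₁ z₂)),
    (ins p (a + d + d) (puLet puU₂ p κ ρ x₁ x₂ y₁ y₂ z₁ z₂),
      ins p (a + d) (puLet puV₂ p κ ρ x₁ x₂ y₁ y₂ z₁ z₂),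
      ins p a (puLet puW₂ p κ ρ x₁ x₂ y₁ y₂ z₁ z₂)),
    (ins p (a + d + d) (puLet puU₂' p κ ρ x₁ x₂ y₁ y₂ z₁ z₂),
      ins p (a + d) (puLet puV₂' p κ ρ x₁ x₂ y₁ y₂ z₁ z₂),
      ins p a (puLet puW₂' p κ ρ x₁ x₂ y₁ y₂ z₁ z₂))}

/-- Four elements with pairwise distinct values. -/
theorem injOn_quad {α β : Type*} [DecidableEq α] {f : α → β} {q r s t : α} (h₁ : f q ≠ f r)
    (h₂ : f q ≠ f s) (h₃ : f q ≠ f t) (h₄ : f r ≠ f s) (h₅ : f r ≠ f t) (h₆ : f s ≠ f t) :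
    Set.InjOn f ({q, r, s, t} : Finset α) := by
  intro x hx y hy e
  simp only [coe_insert, coe_singleton, Set.mem_insert_iff, Set.mem_singleton_iff] at hx hy
  rcases hx with rfl | rfl | rfl | rfl <;> rcases hy with rfl | rfl | rfl | rfl <;>
    first | rfl | exact absurd e h₁ | exact absurd e.symm h₁ | exact absurd e h₂ |
      exact absurd e.symm h₂ | exact absurd e h₃ | exact absurd e.symm h₃ | exact absurd e h₄ |
      exact absurd e.symm h₄ | exact absurd e h₅ | exact absurd e.symm h₅ | exact absurd e h₆ |
      exact absurd e.symm h₆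

/-! ## §2 The PURE core -/

/-- PURE CORE at a permutation pivot `p` with `x₁ₚ = x₂ₚ = a`, `y₁ₚ = y₂ₚ = a + 2d`,
`z₁ₚ = z₂ₚ = a + d`: given a perfect matching of every lawful co-size-2 complement one level down
(`ih`) and a permutation tail coordinate `j₀` (flags), the glue of primary direction `d` with the
four auxiliary triples `puT` is a perfect matching of the complement of `({x₁,x₂},{y₁,y₂},{z₁,z₂})`;
the auxiliary triples are recovered from it as its triples of direction `2d`. -/
theorem pure_core {p : Fin (m + 1)} {κ : Fin (m + 1) → Bool} (hp : κ p = false)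
    (ih : ∀ x₁ x₂ y₁ y₂ z₁ z₂ : Word m, x₁ ≠ x₂ → y₁ ≠ y₂ → z₁ ≠ z₂ →
      (∀ j, lawκ (tailκ p κ j) (x₁ j) (x₂ j) (y₁ j) (y₂ j) (z₁ j) (z₂ j) = true) →
      ∃ P, isPMκ (tailκ p κ) P {x₁, x₂} {y₁, y₂} {z₁, z₂} = true)
    (j₀ : Fin m) (hj₀ : κ (p.succAbove j₀) = false) {a d : Fin 3} (hd : d ≠ 0) (ρ : Fin m → Bool)
    {x₁ x₂ y₁ y₂ z₁ z₂ : Word (m + 1)} (hx : x₁ ≠ x₂) (hy : y₁ ≠ y₂) (hz : z₁ ≠ z₂)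
    (hX₁ : x₁ p = a) (hX₂ : x₂ p = a) (hY₁ : y₁ p = a + d + d) (hY₂ : y₂ p = a + d + d)
    (hZ₁ : z₁ p = a + d) (hZ₂ : z₂ p = a + d)
    (hadm : ∀ j, lawκ (κ (p.succAbove j)) (x₁ (p.succAbove j)) (x₂ (p.succAbove j))
      (y₁ (p.succAbove j)) (y₂ (p.succAbove j)) (z₁ (p.succAbove j)) (z₂ (p.succAbove j)) = true) :
    ∃ P, isPMκ κ P {x₁, x₂} {y₁, y₂} {z₁, z₂} = true ∧ puT p a d κ ρ x₁ x₂ y₁ y₂ z₁ z₂ ⊆ P ∧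
      ∀ t ∈ P, t.2.1 p = t.1 p + (d + d) → t ∈ puT p a d κ ρ x₁ x₂ y₁ y₂ z₁ z₂ := by
  obtain ⟨n₁, n₂, n₃⟩ := F3.lift_ne a d hd
  have h3 : a + d + d + d = a := F3.add3 a d
  have H := fun j => puκ_spec (κ (p.succAbove j)) (ρ j) (x₁ (p.succAbove j)) (x₂ (p.succAbove j))
    (y₁ (p.succAbove j)) (y₂ (p.succAbove j)) (z₁ (p.succAbove j)) (z₂ (p.succAbove j)) (hadm j)
  -- the twelve tail words
  obtain ⟨U₁, hU₁⟩ : ∃ w : Word m, w = puLet puU₁ p κ ρ x₁ x₂ y₁ y₂ z₁ z₂ := ⟨_, rfl⟩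
  obtain ⟨V₁, hV₁⟩ : ∃ w : Word m, w = puLet puV₁ p κ ρ x₁ x₂ y₁ y₂ z₁ z₂ := ⟨_, rfl⟩
  obtain ⟨W₁, hW₁⟩ : ∃ w : Word m, w = puLet puW₁ p κ ρ x₁ x₂ y₁ y₂ z₁ z₂ := ⟨_, rfl⟩
  obtain ⟨U₁', hU₁'⟩ : ∃ w : Word m, w = puLet puU₁' p κ ρ x₁ x₂ y₁ y₂ z₁ z₂ := ⟨_, rfl⟩
  obtain ⟨V₁', hV₁'⟩ : ∃ w : Word m, w = puLet puV₁' p κ ρ x₁ x₂ y₁ y₂ z₁ z₂ := ⟨_, rfl⟩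
  obtain ⟨W₁', hW₁'⟩ : ∃ w : Word m, w = puLet puW₁' p κ ρ x₁ x₂ y₁ y₂ z₁ z₂ := ⟨_, rfl⟩
  obtain ⟨U₂, hU₂⟩ : ∃ w : Word m, w = puLet puU₂ p κ ρ x₁ x₂ y₁ y₂ z₁ z₂ := ⟨_, rfl⟩
  obtain ⟨V₂, hV₂⟩ : ∃ w : Word m, w = puLet puV₂ p κ ρ x₁ x₂ y₁ y₂ z₁ z₂ := ⟨_, rfl⟩
  obtain ⟨W₂, hW₂⟩ : ∃ w : Word m, w = puLet puW₂ p κ ρ x₁ x₂ y₁ y₂ z₁ z₂ := ⟨_, rfl⟩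
  obtain ⟨U₂', hU₂'⟩ : ∃ w : Word m, w = puLet puU₂' p κ ρ x₁ x₂ y₁ y₂ z₁ z₂ := ⟨_, rfl⟩
  obtain ⟨V₂', hV₂'⟩ : ∃ w : Word m, w = puLet puV₂' p κ ρ x₁ x₂ y₁ y₂ z₁ z₂ := ⟨_, rfl⟩
  obtain ⟨W₂', hW₂'⟩ : ∃ w : Word m, w = puLet puW₂' p κ ρ x₁ x₂ y₁ y₂ z₁ z₂ := ⟨_, rfl⟩
  -- rows lie in the tail frame
  have R₁ : ((U₁, V₁, W₁) : Tr3 m) ∈ frame (tailκ p κ) := by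
    rw [mem_frame]; intro j; rw [hU₁, hV₁, hW₁]; exact (H j).1
  have R₁' : ((U₁', V₁', W₁') : Tr3 m) ∈ frame (tailκ p κ) := by
    rw [mem_frame]; intro j; rw [hU₁', hV₁', hW₁']; exact (H j).2.1
  have R₂ : ((U₂, V₂, W₂) : Tr3 m) ∈ frame (tailκ p κ) := by
    rw [mem_frame]; intro j; rw [hU₂, hV₂, hW₂]; exact (H j).2.2.1
  have R₂' : ((U₂', V₂', W₂') : Tr3 m) ∈ frame (tailκ p κ) := by
    rw [mem_frame]; intro j; rw [hU₂', hV₂', hW₂']; exact (H j).2.2.2.1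
  -- the three slot instances are lawful one level down
  have La : ∀ j, lawκ (tailκ p κ j) (tl p x₁ j) (tl p x₂ j) (V₂ j) (V₂' j) (W₁ j) (W₁' j) = true :=
    fun j => by rw [hV₂, hV₂', hW₁, hW₁']; exact (H j).2.2.2.2.1
  have Lb : ∀ j, lawκ (tailκ p κ j) (U₁ j) (U₁' j) (tl p y₁ j) (tl p y₂ j) (W₂ j) (W₂' j) = true :=
    fun j => by rw [hU₁, hU₁', hW₂, hW₂']; exact (H j).2.2.2.2.2.1
  have Lc : ∀ j, lawκ (tailκ p κ j) (U₂ j) (U₂' j) (V₁ j) (V₁' j) (tl p z₁ j) (tl p z₂ j) = true :=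
    fun j => by rw [hU₂, hU₂', hV₁, hV₁']; exact (H j).2.2.2.2.2.2.1
  -- the flags, from the permutation tail coordinate `j₀`
  have Fl := (H j₀).2.2.2.2.2.2.2 hj₀
  have G₁ : U₁ ≠ U₁' := fun e => Fl.1 (by have h := congrFun e j₀; rw [hU₁, hU₁'] at h; exact h)
  have G₂ : V₁ ≠ V₁' := fun e => Fl.2.1 (by have h := congrFun e j₀; rw [hV₁, hV₁'] at h; exact h)
  have G₃ : W₁ ≠ W₁' := fun e => Fl.2.2.1 (by
    have h := congrFun e j₀; rw [hW₁, hW₁'] at h; exact h)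
  have G₄ : U₂ ≠ U₂' := fun e => Fl.2.2.2.1 (by
    have h := congrFun e j₀; rw [hU₂, hU₂'] at h; exact h)
  have G₅ : V₂ ≠ V₂' := fun e => Fl.2.2.2.2.1 (by
    have h := congrFun e j₀; rw [hV₂, hV₂'] at h; exact h)
  have G₆ : W₂ ≠ W₂' := fun e => Fl.2.2.2.2.2 (by
    have h := congrFun e j₀; rw [hW₂, hW₂'] at h; exact h)
  -- the three sub-matchings
  obtain ⟨Qa, hQa⟩ := ih (tl p x₁) (tl p x₂) V₂ V₂' W₁ W₁' (tl_ne hx (hX₁.trans hX₂.symm)) G₅ G₃ La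
  obtain ⟨Qb, hQb⟩ := ih U₁ U₁' (tl p y₁) (tl p y₂) W₂ W₂' G₁ (tl_ne hy (hY₁.trans hY₂.symm)) G₆ Lb
  obtain ⟨Qc, hQc⟩ := ih U₂ U₂' V₁ V₁' (tl p z₁) (tl p z₂) G₄ G₂ (tl_ne hz (hZ₁.trans hZ₂.symm)) Lc
  -- the auxiliary triples
  obtain ⟨T₁, hT₁⟩ : ∃ T : Tr3 (m + 1), T = (ins p (a + d) U₁, ins p a V₁, ins p (a + d + d) W₁) :=
    ⟨_, rfl⟩
  obtain ⟨T₁', hT₁'⟩ : ∃ T : Tr3 (m + 1),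
      T = (ins p (a + d) U₁', ins p a V₁', ins p (a + d + d) W₁') := ⟨_, rfl⟩
  obtain ⟨T₂, hT₂⟩ : ∃ T : Tr3 (m + 1), T = (ins p (a + d + d) U₂, ins p (a + d) V₂, ins p a W₂) :=
    ⟨_, rfl⟩
  obtain ⟨T₂', hT₂'⟩ : ∃ T : Tr3 (m + 1),
      T = (ins p (a + d + d) U₂', ins p (a + d) V₂', ins p a W₂') := ⟨_, rfl⟩
  have hAux : puT p a d κ ρ x₁ x₂ y₁ y₂ z₁ z₂ = {T₁, T₁', T₂, T₂'} := by
    rw [hT₁, hT₁', hT₂, hT₂', hU₁, hV₁, hW₁, hU₁', hV₁', hW₁', hU₂, hV₂, hW₂, hU₂', hV₂', hW₂']; rfl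
  rw [hAux]
  refine ⟨glue p d {T₁, T₁', T₂, T₂'}
      fun a' => if a' = a then Qa else if a' = a + d then Qb else Qc,
    ?_, fun t ht => mem_glue.2 (Or.inl ht), ?_⟩
  · refine isPMκ_glue hp hd ?_ ?_ ?_ ?_ ?_ ?_ ?_ ?_
    · intro t ht
      simp only [mem_insert, mem_singleton] at ht
      rcases ht with rfl | rfl | rfl | rfl
      · rw [hT₁]; exact (mk3_mem_frame hp).2 ⟨⟨n₁.symm, n₃, n₂⟩, R₁⟩
      · rw [hT₁']; exact (mk3_mem_frame hp).2 ⟨⟨n₁.symm, n₃, n₂⟩, R₁'⟩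
      · rw [hT₂]; exact (mk3_mem_frame hp).2 ⟨⟨n₂.symm, n₁.symm, n₃.symm⟩, R₂⟩
      · rw [hT₂']; exact (mk3_mem_frame hp).2 ⟨⟨n₂.symm, n₁.symm, n₃.symm⟩, R₂'⟩
    · refine injOn_quad ?_ ?_ ?_ ?_ ?_ ?_ <;>
        simp [hT₁, hT₁', hT₂, hT₂', ins_inj, n₂, G₁, G₄]
    · refine injOn_quad ?_ ?_ ?_ ?_ ?_ ?_ <;>
        simp [hT₁, hT₁', hT₂, hT₂', ins_inj, n₁, G₂, G₅]
    · refine injOn_quad ?_ ?_ ?_ ?_ ?_ ?_ <;>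
        simp [hT₁, hT₁', hT₂, hT₂', ins_inj, n₃.symm, G₃, G₆]
    · intro t ht
      simp only [mem_insert, mem_singleton] at ht
      rcases ht with rfl | rfl | rfl | rfl
      · rw [hT₁]; simp [ins_eq_iff, hX₁, hX₂, n₁.symm]
      · rw [hT₁']; simp [ins_eq_iff, hX₁, hX₂, n₁.symm]
      · rw [hT₂]; simp [ins_eq_iff, hX₁, hX₂, n₃.symm]
      · rw [hT₂']; simp [ins_eq_iff, hX₁, hX₂, n₃.symm]
    · intro t ht
      simp only [mem_insert, mem_singleton] at ht
      rcases ht with rfl | rfl | rfl | rfl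
      · rw [hT₁]; simp [ins_eq_iff, hY₁, hY₂, n₃]
      · rw [hT₁']; simp [ins_eq_iff, hY₁, hY₂, n₃]
      · rw [hT₂]; simp [ins_eq_iff, hY₁, hY₂, n₂]
      · rw [hT₂']; simp [ins_eq_iff, hY₁, hY₂, n₂]
    · intro t ht
      simp only [mem_insert, mem_singleton] at ht
      rcases ht with rfl | rfl | rfl | rfl
      · rw [hT₁]; simp [ins_eq_iff, hZ₁, hZ₂, n₂.symm]
      · rw [hT₁']; simp [ins_eq_iff, hZ₁, hZ₂, n₂.symm]
      · rw [hT₂]; simp [ins_eq_iff, hZ₁, hZ₂, n₁]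
      · rw [hT₂']; simp [ins_eq_iff, hZ₁, hZ₂, n₁]
    · intro a'
      rcases F3.cases3 a d a' hd with rfl | rfl | rfl
      · have e1 : layer p a' ({x₁, x₂} ∪ ({T₁, T₁', T₂, T₂'} : Finset (Tr3 (m + 1))).image
            (fun t => t.1)) = {tl p x₁, tl p x₂} := by
          ext u; simp [hT₁, hT₁', hT₂, hT₂', ins_eq_iff, hX₁, hX₂, n₁, n₃]
        have e2 : layer p (a' + d) ({y₁, y₂} ∪ ({T₁, T₁', T₂, T₂'} : Finset (Tr3 (m + 1))).image
            (fun t => t.2.1)) = {V₂, V₂'} := by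
          ext u; simp [hT₁, hT₁', hT₂, hT₂', ins_eq_iff, hY₁, hY₂, n₂, n₁.symm]
        have e3 : layer p (a' + d + d) ({z₁, z₂} ∪ ({T₁, T₁', T₂, T₂'} : Finset (Tr3 (m + 1))).image
            (fun t => t.2.2)) = {W₁, W₁'} := by
          ext u; simp [hT₁, hT₁', hT₂, hT₂', ins_eq_iff, hZ₁, hZ₂, n₂.symm, n₃.symm]
        rw [e1, e2, e3, if_pos rfl]
        exact hQa
      · have e1 : layer p (a + d) ({x₁, x₂} ∪ ({T₁, T₁', T₂, T₂'} : Finset (Tr3 (m + 1))).image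
            (fun t => t.1)) = {U₁, U₁'} := by
          ext u; simp [hT₁, hT₁', hT₂, hT₂', ins_eq_iff, hX₁, hX₂, n₁.symm, n₂]
        have e2 : layer p (a + d + d) ({y₁, y₂} ∪ ({T₁, T₁', T₂, T₂'} : Finset (Tr3 (m + 1))).image
            (fun t => t.2.1)) = {tl p y₁, tl p y₂} := by
          ext u; simp [hT₁, hT₁', hT₂, hT₂', ins_eq_iff, hY₁, hY₂, n₃.symm, n₂.symm]
        have e3 : layer p (a + d + d + d) ({z₁, z₂} ∪
            ({T₁, T₁', T₂, T₂'} : Finset (Tr3 (m + 1))).image (fun t => t.2.2)) = {W₂, W₂'} := by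
          ext u; simp [hT₁, hT₁', hT₂, hT₂', ins_eq_iff, hZ₁, hZ₂, h3, n₁, n₃]
        rw [e1, e2, e3, if_neg n₁.symm, if_pos rfl]
        exact hQb
      · have e1 : layer p (a + d + d) ({x₁, x₂} ∪ ({T₁, T₁', T₂, T₂'} : Finset (Tr3 (m + 1))).image
            (fun t => t.1)) = {U₂, U₂'} := by
          ext u; simp [hT₁, hT₁', hT₂, hT₂', ins_eq_iff, hX₁, hX₂, n₃.symm, n₂.symm]
        have e2 : layer p (a + d + d + d) ({y₁, y₂} ∪
            ({T₁, T₁', T₂, T₂'} : Finset (Tr3 (m + 1))).image (fun t => t.2.1)) = {V₁, V₁'} := by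
          ext u; simp [hT₁, hT₁', hT₂, hT₂', ins_eq_iff, hY₁, hY₂, h3, n₃, n₁]
        have e3 : layer p (a + d + d + d + d) ({z₁, z₂} ∪
            ({T₁, T₁', T₂, T₂'} : Finset (Tr3 (m + 1))).image (fun t => t.2.2)) =
            {tl p z₁, tl p z₂} := by
          ext u; simp [hT₁, hT₁', hT₂, hT₂', ins_eq_iff, hZ₁, hZ₂, h3, n₂, n₁.symm]
        rw [e1, e2, e3, if_neg n₃.symm, if_neg n₂.symm]
        exact hQc
  · intro t ht h2
    by_contra hA
    rw [glue_dir ht hA] at h2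
    exact F3.dir_ne _ _ hd h2

/-! ## §3 The PURE slice: two matchings -/

/-- In `Fin 3`: the PURE letters `x, y = x + e, z = x + 2e` rewritten with the primary direction
`d = 2e`: `z = x + d`, `y = x + 2d`. -/
theorem F3.half : ∀ a y : Fin 3, y - a ≠ 0 →
    ∃ d, d ≠ 0 ∧ a + (y - a) + (y - a) = a + d ∧ a + (y - a) = a + d + d := by
  decide

/-- Every auxiliary PURE triple has direction `2d` (`B`-letter `= A`-letter `+ 2d` at the pivot). -/
theorem puT_dir {p : Fin (m + 1)} {a d : Fin 3} {κ : Fin (m + 1) → Bool} {ρ : Fin m → Bool}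
    {x₁ x₂ y₁ y₂ z₁ z₂ : Word (m + 1)} {t : Tr3 (m + 1)}
    (ht : t ∈ puT p a d κ ρ x₁ x₂ y₁ y₂ z₁ z₂) : t.2.1 p = t.1 p + (d + d) := by
  simp only [puT, mem_insert, mem_singleton] at ht
  rcases ht with rfl | rfl | rfl | rfl <;> simp only [ins_apply_same] <;> exact (F3.dir2 _ _).2.1

/-- **PURE SLICE, TWO MATCHINGS.**  At a permutation pivot `p` with the `x`'s and the `y`'s
doubled (hence PURE, `…PowSubTwoRules.pure_letters`), given matchings one level down (`ih`), a
permutation tail coordinate `j₀` (flags) and a cw tail coordinate `j₁`, the complement of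
`({x₁,x₂}, {y₁,y₂}, {z₁,z₂})` in `frame κ` has TWO DISTINCT perfect matchings: the PURE cores with
the primary cw rule everywhere, resp. the alternative cw rule at `j₁`; they differ because their
auxiliary triples (the direction-`2d` triples) would otherwise give the same pair of auxiliary row
sets at `j₁`, which `puκ_diff` excludes. -/
theorem twoPMκ_pure {p : Fin (m + 1)} {κ : Fin (m + 1) → Bool} (hp : κ p = false)
    (ih : ∀ x₁ x₂ y₁ y₂ z₁ z₂ : Word m, x₁ ≠ x₂ → y₁ ≠ y₂ → z₁ ≠ z₂ →
      (∀ j, lawκ (tailκ p κ j) (x₁ j) (x₂ j) (y₁ j) (y₂ j) (z₁ j) (z₂ j) = true) →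
      ∃ P, isPMκ (tailκ p κ) P {x₁, x₂} {y₁, y₂} {z₁, z₂} = true)
    (j₀ : Fin m) (hj₀ : κ (p.succAbove j₀) = false) (j₁ : Fin m) (hj₁ : κ (p.succAbove j₁) = true)
    {x₁ x₂ y₁ y₂ z₁ z₂ : Word (m + 1)} (hx : x₁ ≠ x₂) (hy : y₁ ≠ y₂) (hz : z₁ ≠ z₂)
    (hadm : ∀ i, lawκ (κ i) (x₁ i) (x₂ i) (y₁ i) (y₂ i) (z₁ i) (z₂ i) = true)
    (hxp : x₁ p = x₂ p) (hyp : y₁ p = y₂ p) :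
    ∃ P₁ P₂, P₁ ≠ P₂ ∧ isPMκ κ P₁ {x₁, x₂} {y₁, y₂} {z₁, z₂} = true ∧
      isPMκ κ P₂ {x₁, x₂} {y₁, y₂} {z₁, z₂} = true := by
  -- the letters at the pivot: `y = x + e`, `z = x + 2e`; primary direction `d = 2e`
  have hlaw : twice (x₁ p) (x₂ p) (y₁ p) (y₂ p) (z₁ p) (z₂ p) = true := by
    have h := hadm p; rw [hp] at h; exact h
  obtain ⟨he, hy', hz₁', hz₂'⟩ := pure_letters _ _ _ _ _ _ hlaw hxp hyp
  obtain ⟨d, hd, q₁, q₂⟩ := F3.half (x₁ p) (y₁ p) he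
  have hX₂ : x₂ p = x₁ p := hxp.symm
  have hZ₁ : z₁ p = x₁ p + d := hz₁'.trans q₁
  have hZ₂ : z₂ p = x₁ p + d := hz₂'.trans q₁
  have hY₁ : y₁ p = x₁ p + d + d := hy'.trans q₂
  have hY₂ : y₂ p = x₁ p + d + d := hyp.symm.trans hY₁
  obtain ⟨a, hX₁⟩ : ∃ a, x₁ p = a := ⟨_, rfl⟩
  rw [hX₁] at hX₂ hZ₁ hZ₂ hY₁ hY₂
  have hadm' : ∀ j, lawκ (κ (p.succAbove j)) (x₁ (p.succAbove j)) (x₂ (p.succAbove j))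
      (y₁ (p.succAbove j)) (y₂ (p.succAbove j)) (z₁ (p.succAbove j)) (z₂ (p.succAbove j)) = true :=
    fun j => hadm _
  obtain ⟨P₀, h₀, hS₀, hD₀⟩ := pure_core hp ih j₀ hj₀ hd (fun _ => false) hx hy hz hX₁ hX₂ hY₁ hY₂
    hZ₁ hZ₂ hadm'
  obtain ⟨P₁, h₁, hS₁, hD₁⟩ := pure_core hp ih j₀ hj₀ hd (fun j => decide (j = j₁)) hx hy hz hX₁ hX₂
    hY₁ hY₂ hZ₁ hZ₂ hadm'
  refine ⟨P₀, P₁, fun heq => ?_, h₀, h₁⟩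
  -- the auxiliary triples are intrinsic (direction `2d`), so the two sets of them coincide
  have M : puT p a d κ (fun _ => false) x₁ x₂ y₁ y₂ z₁ z₂ ⊆
      puT p a d κ (fun j => decide (j = j₁)) x₁ x₂ y₁ y₂ z₁ z₂ :=
    fun t ht => hD₁ t (by rw [← heq]; exact hS₀ ht) (puT_dir ht)
  have M' : puT p a d κ (fun j => decide (j = j₁)) x₁ x₂ y₁ y₂ z₁ z₂ ⊆
      puT p a d κ (fun _ => false) x₁ x₂ y₁ y₂ z₁ z₂ :=
    fun t ht => hD₀ t (by rw [heq]; exact hS₁ ht) (puT_dir ht)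
  obtain ⟨n₁, n₂, n₃⟩ := F3.lift_ne a d hd
  simp only [puT, insert_subset_iff, singleton_subset_iff, mem_insert, mem_singleton,
    Prod.mk.injEq, ins_inj, n₁, n₂, n₃, n₁.symm, n₂.symm, n₃.symm, true_and, false_and,
    and_false, or_false, false_or] at M M'
  -- read both rules at the cw tail coordinate `j₁`
  have L : lawκ true (x₁ (p.succAbove j₁)) (x₂ (p.succAbove j₁)) (y₁ (p.succAbove j₁))
      (y₂ (p.succAbove j₁)) (z₁ (p.succAbove j₁)) (z₂ (p.succAbove j₁)) = true := by
    have h := hadm (p.succAbove j₁); rwa [hj₁] at h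
  have ev : ∀ {f g : Bool → Bool → Fin 3 → Fin 3 → Fin 3 → Fin 3 → Fin 3 → Fin 3 → Fin 3},
      puLet f p κ (fun _ => false) x₁ x₂ y₁ y₂ z₁ z₂ =
        puLet g p κ (fun j => decide (j = j₁)) x₁ x₂ y₁ y₂ z₁ z₂ →
      f true false (x₁ (p.succAbove j₁)) (x₂ (p.succAbove j₁)) (y₁ (p.succAbove j₁))
        (y₂ (p.succAbove j₁)) (z₁ (p.succAbove j₁)) (z₂ (p.succAbove j₁)) =
      g true true (x₁ (p.succAbove j₁)) (x₂ (p.succAbove j₁)) (y₁ (p.succAbove j₁))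
        (y₂ (p.succAbove j₁)) (z₁ (p.succAbove j₁)) (z₂ (p.succAbove j₁)) := by
    intro f g e; simpa [hj₁] using congrFun e j₁
  have ev' : ∀ {f g : Bool → Bool → Fin 3 → Fin 3 → Fin 3 → Fin 3 → Fin 3 → Fin 3 → Fin 3},
      puLet f p κ (fun j => decide (j = j₁)) x₁ x₂ y₁ y₂ z₁ z₂ =
        puLet g p κ (fun _ => false) x₁ x₂ y₁ y₂ z₁ z₂ →
      f true true (x₁ (p.succAbove j₁)) (x₂ (p.succAbove j₁)) (y₁ (p.succAbove j₁))
        (y₂ (p.succAbove j₁)) (z₁ (p.succAbove j₁)) (z₂ (p.succAbove j₁)) =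
      g true false (x₁ (p.succAbove j₁)) (x₂ (p.succAbove j₁)) (y₁ (p.succAbove j₁))
        (y₂ (p.succAbove j₁)) (z₁ (p.succAbove j₁)) (z₂ (p.succAbove j₁)) := by
    intro f g e; simpa [hj₁] using congrFun e j₁
  obtain ⟨M₁, M₁', M₂, M₂'⟩ := M
  obtain ⟨N₁, N₁', N₂, N₂'⟩ := M'
  refine puκ_diff _ _ _ _ _ _ L ⟨⟨?_, ?_, ?_, ?_⟩, ?_, ?_, ?_, ?_⟩
  · rcases M₁ with ⟨e₁, e₂, e₃⟩ | ⟨e₁, e₂, e₃⟩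
    · exact Or.inl (Prod.ext (ev e₁) (Prod.ext (ev e₂) (ev e₃)))
    · exact Or.inr (Prod.ext (ev e₁) (Prod.ext (ev e₂) (ev e₃)))
  · rcases M₁' with ⟨e₁, e₂, e₃⟩ | ⟨e₁, e₂, e₃⟩
    · exact Or.inl (Prod.ext (ev e₁) (Prod.ext (ev e₂) (ev e₃)))
    · exact Or.inr (Prod.ext (ev e₁) (Prod.ext (ev e₂) (ev e₃)))
  · rcases N₁ with ⟨e₁, e₂, e₃⟩ | ⟨e₁, e₂, e₃⟩
    · exact Or.inl (Prod.ext (ev' e₁) (Prod.ext (ev' e₂) (ev' e₃)))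
    · exact Or.inr (Prod.ext (ev' e₁) (Prod.ext (ev' e₂) (ev' e₃)))
  · rcases N₁' with ⟨e₁, e₂, e₃⟩ | ⟨e₁, e₂, e₃⟩
    · exact Or.inl (Prod.ext (ev' e₁) (Prod.ext (ev' e₂) (ev' e₃)))
    · exact Or.inr (Prod.ext (ev' e₁) (Prod.ext (ev' e₂) (ev' e₃)))
  · rcases M₂ with ⟨e₁, e₂, e₃⟩ | ⟨e₁, e₂, e₃⟩
    · exact Or.inl (Prod.ext (ev e₁) (Prod.ext (ev e₂) (ev e₃)))
    · exact Or.inr (Prod.ext (ev e₁) (Prod.ext (ev e₂) (ev e₃)))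
  · rcases M₂' with ⟨e₁, e₂, e₃⟩ | ⟨e₁, e₂, e₃⟩
    · exact Or.inl (Prod.ext (ev e₁) (Prod.ext (ev e₂) (ev e₃)))
    · exact Or.inr (Prod.ext (ev e₁) (Prod.ext (ev e₂) (ev e₃)))
  · rcases N₂ with ⟨e₁, e₂, e₃⟩ | ⟨e₁, e₂, e₃⟩
    · exact Or.inl (Prod.ext (ev' e₁) (Prod.ext (ev' e₂) (ev' e₃)))
    · exact Or.inr (Prod.ext (ev' e₁) (Prod.ext (ev' e₂) (ev' e₃)))
  · rcases N₂' with ⟨e₁, e₂, e₃⟩ | ⟨e₁, e₂, e₃⟩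
    · exact Or.inl (Prod.ext (ev' e₁) (Prod.ext (ev' e₂) (ev' e₃)))
    · exact Or.inr (Prod.ext (ev' e₁) (Prod.ext (ev' e₂) (ev' e₃)))

end Summit.MatrixMultiplication.MatrixMultiplication.Theorems.OutsiderSandwichToricCeilingPowMixedPure
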